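import Summits.AtomisticToContinuum.HydrodynamicLimit.Theorems.CollisionIsometryCLTAdaptedWeightCLTBlockHDissipation
import Summits.AtomisticToContinuum.HydrodynamicLimit.Theorems.RelayRaceLocalityConeLocalisationBubbleZoom
import Literature.Analysis.FunctionSpaces.TorusMollifier

/-!
# Stub `stub_coarsening` (S6) of the line `block-h-dissipation-closure` for the crux `AdaptedWeightCLT`
(stmt-AtomisticToContinuum-14868, rev-12 TIME-LOCAL form; `--supports`), helper file: ADMISSIBLE CELL FAMILIES EXIST

The coarsening step S6 receives kinetic closure for EVERY admissible cell family at a cell exponent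
`γc ∈ (1/6, 1/3)` and must instantiate that hypothesis with ONE such family. This dynamics-free file supplies
it, at every exponent `γ ≥ 0`: the standard torus mollifier `Torus.kernel ε` of
`Literature/Analysis/FunctionSpaces/TorusMollifier.lean` (a normalised `ContDiffBump` of `ℝ³` transplanted to
`𝕋³` through the centred fundamental domain) at the radius `ε_N = min (1/4, (N+1)^{-γ})` is an
`AdmissibleKernel γ C` family (`admissibleKernel_cellKer`, `exists_admissibleKernel`):

* smooth (`Torus.isSmooth_kernel`, needs `ε ≤ 1/4`), nonnegative, unit mass;
* supported in the minimal-image ball of radius `ε_N ≤ (N+1)^{-γ}`: the kernel lives where the centred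
  representative has Euclidean norm `< ε`, and that norm IS the minimal-image distance to the origin
  (`Bubble.norm_reprc_eq_euclidDist`);
* height `≤ ε_N⁻³ · sup ρ₁ ≤ 64 sup ρ₁ · (N+1)^{3γ}` and gradient `≤ ε_N⁻⁴ · sup ‖Dρ₁‖ ≤ 256 sup ‖Dρ₁‖ · (N+1)^{4γ}`
  (`ε_N⁻¹ ≤ 4 (N+1)^{γ}`; the profile `ρ₁` and its derivative are continuous with compact support, hence
  bounded).

Registered anchor: `bhCoarsening_kernel_anchor` (`∀ γ ≥ 0, ∃ C ψ, AdmissibleKernel γ C ψ`).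
-/

namespace Summit.AtomisticToContinuum.HydrodynamicLimit.Theorems.BlockHDissipation

open scoped BigOperators Topology Classical
open Filter Set MeasureTheory
open Literature.Analysis.FunctionSpaces
open Summit.AtomisticToContinuum.HydrodynamicLimit.Theorems.ContactSourceDuhamel (T3 V3)
open Summit.AtomisticToContinuum.HydrodynamicLimit.Theorems.ContactSourceDuhamel.TimeLocal

noncomputable section

namespace Coarsening

/-! ## The cell radius `ε_N = min (1/4, (N+1)^{-γ})` -/

/-- The cell radius `ε_N = min (1/4) ((N+1)^{-γ})` (capped at `1/4` so that the torus mollifier is smooth). -/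
def cellRad (γ : ℝ) (N : ℕ) : ℝ := min (1 / 4) (((N : ℝ) + 1) ^ (-γ))

/-- `0 < ε_N`. -/
theorem cellRad_pos (γ : ℝ) (N : ℕ) : 0 < cellRad γ N :=
  lt_min (by norm_num) (Real.rpow_pos_of_pos (by positivity) _)

/-- `ε_N ≤ 1/4`. -/
theorem cellRad_le_quarter (γ : ℝ) (N : ℕ) : cellRad γ N ≤ 1 / 4 := min_le_left _ _

/-- `ε_N ≤ (N+1)^{-γ}`. -/
theorem cellRad_le_rpow (γ : ℝ) (N : ℕ) : cellRad γ N ≤ ((N : ℝ) + 1) ^ (-γ) := min_le_right _ _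

/-- `ε_N⁻¹ ≤ 4 (N+1)^{γ}` for `γ ≥ 0`. -/
theorem inv_cellRad_le {γ : ℝ} (hγ : 0 ≤ γ) (N : ℕ) : (cellRad γ N)⁻¹ ≤ 4 * ((N : ℝ) + 1) ^ γ := by
  have hN : (1 : ℝ) ≤ (N : ℝ) + 1 := by simp
  have hp : 1 ≤ ((N : ℝ) + 1) ^ γ := Real.one_le_rpow hN hγ
  unfold cellRad
  rcases min_cases (1 / 4 : ℝ) (((N : ℝ) + 1) ^ (-γ)) with ⟨h, _⟩ | ⟨h, _⟩
  · rw [h]; norm_num; linarith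
  · rw [h, Real.rpow_neg (by positivity), inv_inv]; linarith

/-- `ε_N⁻ᵏ ≤ 4ᵏ (N+1)^{kγ}` for `γ ≥ 0`. -/
theorem inv_cellRad_pow_le {γ : ℝ} (hγ : 0 ≤ γ) (N k : ℕ) :
    (cellRad γ N ^ k)⁻¹ ≤ 4 ^ k * ((N : ℝ) + 1) ^ ((k : ℝ) * γ) := by
  rw [mul_comm (k : ℝ) γ, Real.rpow_mul (by positivity), Real.rpow_natCast, ← inv_pow, ← mul_pow]
  exact pow_le_pow_left₀ (inv_nonneg.2 (cellRad_pos γ N).le) (inv_cellRad_le hγ N) k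

/-! ## Sup bounds of the profile and of its derivative -/

/-- The unit-mass profile `ρ₁` of `ℝ³` is bounded: `∃ M ≥ 0, ρ₁ ≤ M`. -/
theorem exists_profileOne_le : ∃ M : ℝ, 0 ≤ M ∧ ∀ v, Torus.profileOne (Fin 3) v ≤ M := by
  obtain ⟨M, hM⟩ := (Torus.contDiff_profileOne (d := Fin 3)).continuous.bounded_above_of_compact_support
    Torus.hasCompactSupport_profileOne
  exact ⟨M, (norm_nonneg _).trans (hM 0), fun v => (Real.le_norm_self _).trans (hM v)⟩

/-- The derivative of `ρ₁` is bounded: `∃ M' ≥ 0, ‖Dρ₁‖ ≤ M'`. -/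
theorem exists_norm_fderiv_profileOne_le :
    ∃ M' : ℝ, 0 ≤ M' ∧ ∀ v, ‖fderiv ℝ (Torus.profileOne (Fin 3)) v‖ ≤ M' := by
  obtain ⟨M', hM'⟩ := (Torus.continuous_fderiv_profileOne (d := Fin 3)).bounded_above_of_compact_support
    (Torus.hasCompactSupport_profileOne.fderiv (𝕜 := ℝ))
  exact ⟨M', (norm_nonneg _).trans (hM' 0), hM'⟩

/-! ## The torus kernel: height, gradient, support in the minimal-image ball -/

/-- Height of the torus kernel: `kernel ε z ≤ ε⁻³ sup ρ₁` (`0 < ε`). -/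
theorem kernel_le {ε M : ℝ} (hε : 0 < ε) (hM : ∀ v, Torus.profileOne (Fin 3) v ≤ M) (z : T3) :
    Torus.kernel ε z ≤ (ε ^ 3)⁻¹ * M := by
  change Torus.profile ε (Torus.reprc z) ≤ _
  unfold Torus.profile
  rw [Fintype.card_fin]
  exact mul_le_mul_of_nonneg_left (hM _) (inv_nonneg.2 (pow_nonneg hε.le 3))

/-- Gradient of the torus kernel: `‖∇ kernel ε z‖ ≤ ε⁻³ ε⁻¹ sup ‖Dρ₁‖` (`0 < ε ≤ 1/4`). -/
theorem norm_gradient_kernel_le {ε M' : ℝ} (hε : 0 < ε) (hε' : ε ≤ 1 / 4)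
    (hM' : ∀ v, ‖fderiv ℝ (Torus.profileOne (Fin 3)) v‖ ≤ M') (z : T3) :
    ‖Torus.gradient (Torus.kernel ε) z‖ ≤ (ε ^ 3)⁻¹ * ε⁻¹ * M' := by
  rw [Torus.norm_gradient_kernel hε hε', Torus.fderiv_profile, norm_smul, Fintype.card_fin, Real.norm_eq_abs,
    abs_of_nonneg (by positivity)]
  exact mul_le_mul_of_nonneg_left (hM' _) (by positivity)

/-- Support of the torus kernel in the minimal-image ball: `ε ≤ d(z, 0) ⟹ kernel ε z = 0` (`0 < ε`). -/
theorem kernel_eq_zero_of_le_euclidDist {ε : ℝ} (hε : 0 < ε) {z : T3}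
    (hz : ε ≤ Literature.Analysis.FluidPDE.Torus.euclidDist z 0) : Torus.kernel ε z = 0 := by
  rw [← ConeLocalisation.Bubble.norm_reprc_eq_euclidDist] at hz
  exact Torus.transplant_eq_zero_of_le (Torus.support_profile_subset hε) hz

/-! ## The admissible cell family -/

/-- THE CELL FAMILY at exponent `γ`: the torus mollifier at radius `ε_N = min (1/4, (N+1)^{-γ})`. -/
def cellKer (γ : ℝ) (N : ℕ) : T3 → ℝ := Torus.kernel (cellRad γ N)

/-- The constant of the cell family: `max (64 sup ρ₁) (256 sup ‖Dρ₁‖)` for chosen sup bounds. -/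
def cellConst : ℝ :=
  max (4 ^ 3 * Classical.choose exists_profileOne_le) (4 ^ 4 * Classical.choose exists_norm_fderiv_profileOne_le)

/-- **The cell family at exponent `γ ≥ 0` is admissible** with constant `cellConst`. -/
theorem admissibleKernel_cellKer {γ : ℝ} (hγ : 0 ≤ γ) : AdmissibleKernel γ cellConst (cellKer γ) := by
  obtain ⟨hM0, hM⟩ := Classical.choose_spec exists_profileOne_le
  obtain ⟨hM0', hM'⟩ := Classical.choose_spec exists_norm_fderiv_profileOne_le
  set M := Classical.choose exists_profileOne_le
  set M' := Classical.choose exists_norm_fderiv_profileOne_le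
  have hpos := cellRad_pos γ
  have hq := cellRad_le_quarter γ
  refine ⟨fun N => Torus.isSmooth_kernel (hpos N) (hq N), fun N y => Torus.kernel_nonneg (hpos N).le y,
    fun N => Torus.integral_kernel (hpos N) (hq N), fun N y hy => ?_, fun N y => ?_, fun N y => ?_⟩
  · exact kernel_eq_zero_of_le_euclidDist (hpos N) ((cellRad_le_rpow γ N).trans hy)
  · calc cellKer γ N y ≤ (cellRad γ N ^ 3)⁻¹ * M := kernel_le (hpos N) hM y
      _ ≤ 4 ^ 3 * ((N : ℝ) + 1) ^ ((3 : ℕ) * γ) * M :=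
          mul_le_mul_of_nonneg_right (inv_cellRad_pow_le hγ N 3) hM0
      _ ≤ cellConst * ((N : ℝ) + 1) ^ (3 * γ) := by
          rw [Nat.cast_ofNat, mul_right_comm]
          exact mul_le_mul_of_nonneg_right (le_max_left _ _) (Real.rpow_nonneg (by positivity) _)
  · calc ‖Torus.gradient (cellKer γ N) y‖ ≤ (cellRad γ N ^ 3)⁻¹ * (cellRad γ N)⁻¹ * M' :=
          norm_gradient_kernel_le (hpos N) (hq N) hM' y
      _ = (cellRad γ N ^ 4)⁻¹ * M' := by rw [← mul_inv, ← pow_succ]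
      _ ≤ 4 ^ 4 * ((N : ℝ) + 1) ^ ((4 : ℕ) * γ) * M' :=
          mul_le_mul_of_nonneg_right (inv_cellRad_pow_le hγ N 4) hM0'
      _ ≤ cellConst * ((N : ℝ) + 1) ^ (4 * γ) := by
          rw [Nat.cast_ofNat, mul_right_comm]
          exact mul_le_mul_of_nonneg_right (le_max_right _ _) (Real.rpow_nonneg (by positivity) _)

/-- **Admissible kernel families exist at every exponent `γ ≥ 0`.** -/
theorem exists_admissibleKernel {γ : ℝ} (hγ : 0 ≤ γ) : ∃ (C : ℝ) (ψ : ℕ → T3 → ℝ), AdmissibleKernel γ C ψ :=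
  ⟨cellConst, cellKer γ, admissibleKernel_cellKer hγ⟩

end Coarsening

/-- Registered anchor of this helper file (`--supports stmt-AtomisticToContinuum-14868`): ADMISSIBLE KERNEL
FAMILIES EXIST at every exponent `γ ≥ 0` (the cell family fed to the cell-closure hypothesis of S6). -/
theorem bhCoarsening_kernel_anchor : ∀ γ : ℝ, 0 ≤ γ → ∃ (C : ℝ) (ψ : ℕ → T3 → ℝ), AdmissibleKernel γ C ψ :=
  fun _ hγ => Coarsening.exists_admissibleKernel hγ

end

end Summit.AtomisticToContinuum.HydrodynamicLimit.Theorems.BlockHDissipation
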